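import Summits.AnomalousDissipation.AnomalousDissipation.Theorems.SawtoothPulseCascadeK1LocalisedCascadeFibreWindow

/-!
# K1loc, line `Spectral` / thin start — helper: SUMMING WINDOW INEQUALITIES OVER FIBRE BLOCKS (memo v11 §13 «BlockSum»)

Helper file of the prover lane on the crux `K1LocalisedCascade` (stmt-AnomalousDissipation-19491), route
`SawtoothPulseCascade` (S-D fibre ledger, bookkeeping B-5).  A class window whose fibres range over `[Λ₀, Λ_M)` is cut into
blocks `[Λ_m, Λ_{m+1})` (ratio `≤ 8`, `#blocks ≈ 0.3j + C`); on each block `…WindowBlockV/H` / `…StripBlockV/H` give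
`x_m ≤ (u_m + √y_m)²` (junk amplitude `u_m`, pass-through energy `y_m` of the block).  This file does the summation, abstractly:
* `sum_le_sq_sqrt_add_sqrt` — **ℓ²-Minkowski over blocks**: `Σ_m x_m ≤ (√(Σ_m u_m²) + √(Σ_m y_m))²`;
* `sum_sq_le_of_le_geometric` — `u_m ≤ Cθ^m` (`0 ≤ θ < 1`) ⇒ `Σ_{m<M} u_m² ≤ C²/(1 − θ²)`;
* `blockIndicator_sum_eq` — for a monotone threshold sequence `Λ : ℕ → ℤ` the indicators of the blocks `[Λ_m, Λ_{m+1})`, `m < M`,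
  add up to the indicator of `[Λ₀, Λ_M)`;
* **`tsum_blocks_eq`** / **`sum_tsum_blocks_le`** — for a non-negative summable family `c` (e.g. `c k = ‖𝓕v(k)‖²`), a fibre
  coordinate `f` (e.g. `k ↦ |k₁|`) and predicates `P_m ⇒ P`:
  `Σ_{m<M} Σ'_k [Λ_m ≤ f k < Λ_{m+1} ∧ P_m k]·c k ≤ Σ'_k [Λ₀ ≤ f k ∧ P k]·c k` — the pass-through energies of the blocks add up to at
  most the class total (with equality and `P_m = P`, `f < Λ_M` kept, in `tsum_blocks_eq`).
No definitions; no statement about the crux. [cite: Grafakos2014, Prop. 3.2.7 (3)] [problem: turb]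
-/

-- `Summit.<Summit>.<Problem>`: single-conjunct summit, the duplicate namespace segment is deliberate.
set_option linter.dupNamespace false

noncomputable section

namespace Summit.AnomalousDissipation.AnomalousDissipation.Theorems.SawtoothPulseCascade.K1Start

open MeasureTheory Set Filter Topology Function
open Summit.AnomalousDissipation.AnomalousDissipation.Theorems.SawtoothPulseCascade.SpectralLeakage

/-! ## §1 ℓ²-Minkowski over blocks and the geometric junk sum -/

/-- **ℓ²-Minkowski over blocks**: if `x_m ≤ (u_m + √y_m)²` with `u_m, y_m ≥ 0` for `m ∈ s`, then
`Σ_{m∈s} x_m ≤ (√(Σ_{m∈s} u_m²) + √(Σ_{m∈s} y_m))²`. [folklore] -/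
theorem sum_le_sq_sqrt_add_sqrt {ι : Type*} (s : Finset ι) {x u y : ι → ℝ} (hu : ∀ m ∈ s, 0 ≤ u m) (hy : ∀ m ∈ s, 0 ≤ y m)
    (h : ∀ m ∈ s, x m ≤ (u m + Real.sqrt (y m)) ^ 2) :
    ∑ m ∈ s, x m ≤ (Real.sqrt (∑ m ∈ s, u m ^ 2) + Real.sqrt (∑ m ∈ s, y m)) ^ 2 := by
  have h1 : ∑ m ∈ s, x m ≤ ∑ m ∈ s, (u m + Real.sqrt (y m)) ^ 2 := Finset.sum_le_sum h
  have hM := sqrt_sum_add_sq_le s (a := u) (b := fun m => Real.sqrt (y m)) hu (fun m _ => Real.sqrt_nonneg _)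
  have hy' : ∑ m ∈ s, Real.sqrt (y m) ^ 2 = ∑ m ∈ s, y m := Finset.sum_congr rfl fun m hm => Real.sq_sqrt (hy m hm)
  rw [hy'] at hM
  have h0 : 0 ≤ ∑ m ∈ s, (u m + Real.sqrt (y m)) ^ 2 := Finset.sum_nonneg fun m _ => sq_nonneg _
  calc ∑ m ∈ s, x m ≤ ∑ m ∈ s, (u m + Real.sqrt (y m)) ^ 2 := h1
    _ = (Real.sqrt (∑ m ∈ s, (u m + Real.sqrt (y m)) ^ 2)) ^ 2 := (Real.sq_sqrt h0).symm
    _ ≤ _ := pow_le_pow_left₀ (Real.sqrt_nonneg _) hM 2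

/-- **Geometric junk**: `0 ≤ u_m ≤ Cθ^m` (`0 ≤ θ < 1`) ⇒ `Σ_{m<M} u_m² ≤ C²/(1 − θ²)`. [folklore] -/
theorem sum_sq_le_of_le_geometric {u : ℕ → ℝ} {C θ : ℝ} (hθ0 : 0 ≤ θ) (hθ1 : θ < 1) (hu0 : ∀ m, 0 ≤ u m)
    (hu : ∀ m, u m ≤ C * θ ^ m) (M : ℕ) : ∑ m ∈ Finset.range M, u m ^ 2 ≤ C ^ 2 / (1 - θ ^ 2) := by
  have hθ2 : θ ^ 2 < 1 := by nlinarith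
  have hθ20 : 0 ≤ θ ^ 2 := sq_nonneg θ
  have h1 : ∑ m ∈ Finset.range M, u m ^ 2 ≤ ∑ m ∈ Finset.range M, C ^ 2 * (θ ^ 2) ^ m := by
    refine Finset.sum_le_sum fun m _ => ?_
    rw [← pow_mul, mul_comm 2 m, pow_mul, ← mul_pow]
    exact pow_le_pow_left₀ (hu0 m) (hu m) 2
  have h2 : ∑ m ∈ Finset.range M, C ^ 2 * (θ ^ 2) ^ m ≤ C ^ 2 / (1 - θ ^ 2) := by
    rw [← Finset.mul_sum, div_eq_mul_inv]
    refine mul_le_mul_of_nonneg_left ?_ (sq_nonneg C)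
    have hs : Summable fun m : ℕ => (θ ^ 2) ^ m := summable_geometric_of_lt_one hθ20 hθ2
    calc ∑ m ∈ Finset.range M, (θ ^ 2) ^ m ≤ ∑' m : ℕ, (θ ^ 2) ^ m :=
          hs.sum_le_tsum (Finset.range M) fun m _ => pow_nonneg hθ20 m
      _ = (1 - θ ^ 2)⁻¹ := tsum_geometric_of_lt_one hθ20 hθ2
  exact h1.trans h2

/-! ## §2 Block decomposition of indicator-weighted sums -/

/-- **The block indicators add up**: for `Λ : ℕ → ℤ` monotone and an integer `t`,
`Σ_{m<M} [Λ_m ≤ t < Λ_{m+1}] = [Λ₀ ≤ t < Λ_M]`. [folklore] -/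
theorem blockIndicator_sum_eq {Λ : ℕ → ℤ} (hΛ : Monotone Λ) (t : ℤ) (M : ℕ) :
    ∑ m ∈ Finset.range M, (if Λ m ≤ t ∧ t < Λ (m + 1) then (1 : ℝ) else 0) =
      if Λ 0 ≤ t ∧ t < Λ M then (1 : ℝ) else 0 := by
  induction M with
  | zero =>
    simp only [Finset.range_zero, Finset.sum_empty]
    rw [if_neg]; exact fun h => absurd (h.1.trans_lt h.2) (lt_irrefl _)
  | succ M ih =>
    rw [Finset.sum_range_succ, ih]
    have hmono : Λ M ≤ Λ (M + 1) := hΛ (Nat.le_succ M)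
    have h0M : Λ 0 ≤ Λ M := hΛ (Nat.zero_le M)
    by_cases h1 : Λ 0 ≤ t ∧ t < Λ M
    · rw [if_pos h1, if_neg (fun h => absurd (h1.2.trans_le h.1) (lt_irrefl _)), if_pos ⟨h1.1, h1.2.trans_le hmono⟩]; ring
    · rw [if_neg h1]
      by_cases h2 : Λ M ≤ t ∧ t < Λ (M + 1)
      · rw [if_pos h2, if_pos ⟨h0M.trans h2.1, h2.2⟩]; ring
      · rw [if_neg h2, if_neg]
        · ring
        · rintro ⟨h3, h4⟩
          rcases lt_or_ge t (Λ M) with h5 | h5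
          · exact h1 ⟨h3, h5⟩
          · exact h2 ⟨h5, h4⟩

/-- **Block decomposition of a class energy**: for `c ≥ 0` summable, a coordinate `f : ι → ℤ`, a monotone `Λ : ℕ → ℤ` and a
predicate `P`: `Σ'_k [Λ₀ ≤ f k < Λ_M ∧ P k]·c k = Σ_{m<M} Σ'_k [Λ_m ≤ f k < Λ_{m+1} ∧ P k]·c k`. [cite: Grafakos2014, Prop. 3.2.7 (3)] -/
theorem tsum_blocks_eq {ι : Type*} {c : ι → ℝ} (hc : Summable c) (hc0 : ∀ k, 0 ≤ c k) (f : ι → ℤ) {Λ : ℕ → ℤ} (hΛ : Monotone Λ)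
    (P : ι → Prop) [DecidablePred P] (M : ℕ) :
    ∑' k, (if Λ 0 ≤ f k ∧ f k < Λ M ∧ P k then (1 : ℝ) else 0) * c k =
      ∑ m ∈ Finset.range M, ∑' k, (if Λ m ≤ f k ∧ f k < Λ (m + 1) ∧ P k then (1 : ℝ) else 0) * c k := by
  have hI : ∀ (p : Prop) [Decidable p], (0 : ℝ) ≤ (if p then (1 : ℝ) else 0) := fun p _ => by split_ifs <;> norm_num
  have hsm : ∀ m, Summable fun k => (if Λ m ≤ f k ∧ f k < Λ (m + 1) ∧ P k then (1 : ℝ) else 0) * c k := fun m =>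
    hc.of_nonneg_of_le (fun k => mul_nonneg (hI _) (hc0 k)) fun k => by
      split_ifs <;> nlinarith [hc0 k]
  rw [← Summable.tsum_finsetSum fun m _ => hsm m]
  refine tsum_congr fun k => ?_
  rw [← Finset.sum_mul]
  congr 1
  by_cases hP : P k
  · have h := blockIndicator_sum_eq hΛ (f k) M
    simp only [hP, and_true]
    rw [← h]
  · simp [hP]

/-- **The pass-through energies of the blocks add up to at most the class total**: with block predicates `P_m ⇒ P`,
`Σ_{m<M} Σ'_k [Λ_m ≤ f k < Λ_{m+1} ∧ P_m k]·c k ≤ Σ'_k [Λ₀ ≤ f k ∧ P k]·c k`. [cite: Grafakos2014, Prop. 3.2.7 (3)] -/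
theorem sum_tsum_blocks_le {ι : Type*} {c : ι → ℝ} (hc : Summable c) (hc0 : ∀ k, 0 ≤ c k) (f : ι → ℤ) {Λ : ℕ → ℤ}
    (hΛ : Monotone Λ) (P : ι → Prop) [DecidablePred P] (Pm : ℕ → ι → Prop) [∀ m, DecidablePred (Pm m)]
    (hPm : ∀ m k, Pm m k → P k) (M : ℕ) :
    ∑ m ∈ Finset.range M, ∑' k, (if Λ m ≤ f k ∧ f k < Λ (m + 1) ∧ Pm m k then (1 : ℝ) else 0) * c k ≤
      ∑' k, (if Λ 0 ≤ f k ∧ P k then (1 : ℝ) else 0) * c k := by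
  have hI : ∀ (p : Prop) [Decidable p], (0 : ℝ) ≤ (if p then (1 : ℝ) else 0) := fun p _ => by split_ifs <;> norm_num
  have hsP : Summable fun k => (if Λ 0 ≤ f k ∧ P k then (1 : ℝ) else 0) * c k :=
    hc.of_nonneg_of_le (fun k => mul_nonneg (hI _) (hc0 k)) fun k => by split_ifs <;> nlinarith [hc0 k]
  have hsm : ∀ m, Summable fun k => (if Λ m ≤ f k ∧ f k < Λ (m + 1) ∧ P k then (1 : ℝ) else 0) * c k := fun m =>
    hc.of_nonneg_of_le (fun k => mul_nonneg (hI _) (hc0 k)) fun k => by split_ifs <;> nlinarith [hc0 k]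
  -- shrink `P_m` to `P` blockwise, then collect the blocks
  have h1 : ∑ m ∈ Finset.range M, ∑' k, (if Λ m ≤ f k ∧ f k < Λ (m + 1) ∧ Pm m k then (1 : ℝ) else 0) * c k ≤
      ∑ m ∈ Finset.range M, ∑' k, (if Λ m ≤ f k ∧ f k < Λ (m + 1) ∧ P k then (1 : ℝ) else 0) * c k := by
    refine Finset.sum_le_sum fun m _ => ?_
    have hsm' : Summable fun k => (if Λ m ≤ f k ∧ f k < Λ (m + 1) ∧ Pm m k then (1 : ℝ) else 0) * c k :=
      hc.of_nonneg_of_le (fun k => mul_nonneg (hI _) (hc0 k)) fun k => by split_ifs <;> nlinarith [hc0 k]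
    refine hsm'.tsum_le_tsum (fun k => mul_le_mul_of_nonneg_right ?_ (hc0 k)) (hsm m)
    by_cases h : Λ m ≤ f k ∧ f k < Λ (m + 1) ∧ Pm m k
    · rw [if_pos h, if_pos ⟨h.1, h.2.1, hPm m k h.2.2⟩]
    · rw [if_neg h]; exact hI _
  refine h1.trans ?_
  rw [← tsum_blocks_eq hc hc0 f hΛ P M]
  refine (hc.of_nonneg_of_le (fun k => mul_nonneg (hI _) (hc0 k)) fun k => by split_ifs <;> nlinarith [hc0 k]).tsum_le_tsum
    (fun k => mul_le_mul_of_nonneg_right ?_ (hc0 k)) hsP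
  by_cases h : Λ 0 ≤ f k ∧ f k < Λ M ∧ P k
  · rw [if_pos h, if_pos ⟨h.1, h.2.2⟩]
  · rw [if_neg h]; exact hI _

/-- **Splitting one finite window sum along the blocks**: for `W` a finite window and `Λ` monotone,
`Σ_{k∈W, Λ₀ ≤ f k < Λ_M} g k = Σ_{m<M} Σ_{k∈W, Λ_m ≤ f k < Λ_{m+1}} g k`. [folklore] -/
theorem sum_filter_blocks_eq {ι : Type*} (W : Finset ι) (g : ι → ℝ) (f : ι → ℤ) {Λ : ℕ → ℤ} (hΛ : Monotone Λ) (M : ℕ) :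
    ∑ k ∈ W.filter (fun k => Λ 0 ≤ f k ∧ f k < Λ M), g k =
      ∑ m ∈ Finset.range M, ∑ k ∈ W.filter (fun k => Λ m ≤ f k ∧ f k < Λ (m + 1)), g k := by
  classical
  simp_rw [Finset.sum_filter]
  rw [Finset.sum_comm]
  refine Finset.sum_congr rfl fun k _ => ?_
  have h := blockIndicator_sum_eq hΛ (f k) M
  have e : ∀ (p : Prop) [Decidable p], (if p then g k else 0) = (if p then (1 : ℝ) else 0) * g k := fun p _ => by
    split_ifs <;> simp
  rw [e, ← h, Finset.sum_mul]
  exact Finset.sum_congr rfl fun m _ => (e _).symm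

end Summit.AnomalousDissipation.AnomalousDissipation.Theorems.SawtoothPulseCascade.K1Start
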